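import Mathlib
import Literature.Analysis.FluidPDE.NSLerayBlowupRateTopHolds
import Literature.Analysis.FluidPDE.NSCriticalClosureProofs
import Literature.Analysis.FluidPDE.TaoLocalisationHolds
import HarnessLib

/-!
# Route RootDecompLitSlice — cell Uᶜ `CritTameScarIsCritical` (stmt-NavierStokesRegularity-31733):
# the Leray FLOOR of the sup-rate dial (`ρ ≥ 1/2` at a first blow-up)

Helper toward Uᶜ (`--supports 31733`, no item; route-free imports). The sup-rate–clock scar law
(`SupRateClockScarLaw.supRateClockScarRung`, p830649) reads a sup-norm blow-up rate
`‖u(t)‖_∞ ≤ A(T−t)^{−ρ}` as a third coordinate `ρ` of the cell's map. Its admissible range at a FIRST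
BLOW-UP is `ρ ≥ 1/2`: Leray's necessary rate `‖u(t)‖_∞ ≥ c√ν/√(T−t)` (tree theorem
`leray_blowup_rate_top_holds`, ns.S28; the slab boundedness it asks for comes from the rapidly decaying
datum through Tao's localisation, `eLpNorm_uncurry_top_lt_top_of_tao2011`) excludes every `ρ < 1/2`
(`no_supRate_below_half`). So the sup-rate dial ranges over `[1/2, ∞)` (`ρ = 1/2` = Type I), exactly as
the energy exponent ranges over `[b/2, 1/2]` and the clock exponent over `(0, 1]`
(`EnergyClockScarLaw.no_energyLaw_above_half`, `no_clock_above_one`).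

HONEST FRAMING: bookkeeping INSIDE the Tao-vacuous cell Uᶜ; no item, no node, no load of any route
moves (ROOT ⟺ U ∧ P1, critic rows 354/371/563/639). Rung 0: nothing here proves NS regularity.
Decomp-ns route-writer g36. [folklore]
-/

set_option linter.dupNamespace false

noncomputable section

namespace Summit.NavierStokesRegularity.NavierStokesRegularity.Theorems

open MeasureTheory Set Filter Topology Function
open scoped ENNReal
open Literature.Analysis.FluidPDE

namespace SupRateClockScarLaw

/-- **Leray floor of the sup-rate dial**: at a first blow-up (maximal smooth solution on `[0,T)`,
Leray–Hopf on `[0,T]`, rapidly decaying datum) no sup-norm rate `‖u(t,x)‖ ≤ A(T−t)^{−ρ}` with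
`ρ < 1/2` can hold near `T` — Leray's necessary rate `‖u(t)‖_∞ ≥ c√ν(T−t)^{−1/2}`.
[cite: Leray1934, §19 (3.8)–(3.9)] -/
theorem no_supRate_below_half {ρ : ℝ} (hρ : ρ < 1 / 2) {ν T : ℝ} (hν : 0 < ν) (hT : 0 < T)
    {u : ℝ → EuclideanSpace ℝ (Fin 3) → EuclideanSpace ℝ (Fin 3)}
    {p : ℝ → EuclideanSpace ℝ (Fin 3) → ℝ}
    (hmax : IsMaximalSmoothSolution ν 0 u p T) (hLH : IsLerayHopfOn T ν 0 (u 0) u)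
    (hdec : HasRapidSpatialDecay (u 0)) :
    ¬ ∃ A T₃ : ℝ, T₃ < T ∧ ∀ t ∈ Ioo T₃ T, ∀ x, ‖u t x‖ ≤ A * (T - t) ^ (-ρ) := by
  rintro ⟨A, T₃, hT₃, hA⟩
  obtain ⟨c, hc, hler⟩ := leray_blowup_rate_top_holds
  have hbdd := eLpNorm_uncurry_top_lt_top_of_tao2011 tao2011_hasBoundedSobolevNormsOn_holds hν
    hmax.1 hLH hdec
  -- exponent gap `s = 1/2 − ρ > 0`, constant `B = max A 0 + 1 > 0`
  set s : ℝ := 1 / 2 - ρ with hs_def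
  have hs : 0 < s := by rw [hs_def]; linarith
  set B : ℝ := max A 0 + 1 with hB_def
  have hB : 0 < B := by have := le_max_right A 0; rw [hB_def]; linarith
  have hAB : A ≤ B := by have := le_max_left A 0; rw [hB_def]; linarith
  have hcν : 0 < c * Real.sqrt ν := mul_pos hc (Real.sqrt_pos.2 hν)
  -- the window
  set τ₀ : ℝ := (c * Real.sqrt ν / (2 * B)) ^ (1 / s) with hτ₀_def
  have hq : 0 < c * Real.sqrt ν / (2 * B) := by positivity
  have hτ₀ : 0 < τ₀ := Real.rpow_pos_of_pos hq _
  have hgap : 0 < T - max T₃ 0 := sub_pos.2 (max_lt hT₃ hT)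
  set τ : ℝ := min ((T - max T₃ 0) / 2) τ₀ with hτ_def
  have hτ : 0 < τ := lt_min (by positivity) hτ₀
  have hτ1 : τ ≤ (T - max T₃ 0) / 2 := min_le_left _ _
  have hτ2 : τ ≤ τ₀ := min_le_right _ _
  set t : ℝ := T - τ with ht_def
  have hTt : T - t = τ := by rw [ht_def]; ring
  have ht0 : 0 ≤ t := by
    have : max T₃ 0 ≥ 0 := le_max_right _ _
    rw [ht_def]; linarith
  have htT : t < T := by rw [ht_def]; linarith
  have ht₃ : T₃ < t := by
    have : T₃ ≤ max T₃ 0 := le_max_left _ _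
    rw [ht_def]; linarith
  -- Leray from below, the rate hypothesis from above
  have hlow := hler ν T hν hT u p hmax hLH hbdd t ⟨ht0, htT⟩
  have hup : eLpNorm (u t) ∞ volume ≤ ENNReal.ofReal (B * τ ^ (-ρ)) := by
    rw [eLpNorm_exponent_top]
    refine eLpNormEssSup_le_of_ae_bound (Eventually.of_forall fun x => ?_)
    have h := hA t ⟨ht₃, htT⟩ x
    rw [hTt] at h
    exact h.trans (mul_le_mul_of_nonneg_right hAB (Real.rpow_nonneg hτ.le _))
  have hcmp : c * Real.sqrt ν / Real.sqrt τ ≤ B * τ ^ (-ρ) := by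
    have h := hlow.trans hup
    rw [hTt] at h
    exact (ENNReal.ofReal_le_ofReal_iff (by positivity)).1 h
  -- `c√ν ≤ B τ^{1/2−ρ} ≤ B τ₀^{s} = c√ν/2`
  have hsq : 0 < Real.sqrt τ := Real.sqrt_pos.2 hτ
  have h1 : c * Real.sqrt ν ≤ B * τ ^ (-ρ) * Real.sqrt τ := by
    rw [div_le_iff₀ hsq] at hcmp; exact hcmp
  have h2 : B * τ ^ (-ρ) * Real.sqrt τ = B * τ ^ s := by
    rw [Real.sqrt_eq_rpow, mul_assoc, ← Real.rpow_add hτ, hs_def]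
    ring_nf
  have h3 : τ ^ s ≤ τ₀ ^ s := Real.rpow_le_rpow hτ.le hτ2 hs.le
  have h4 : τ₀ ^ s = c * Real.sqrt ν / (2 * B) := by
    rw [hτ₀_def, ← Real.rpow_mul hq.le, one_div_mul_cancel hs.ne', Real.rpow_one]
  have h5 : B * τ ^ s ≤ c * Real.sqrt ν / 2 := by
    calc B * τ ^ s ≤ B * τ₀ ^ s := mul_le_mul_of_nonneg_left h3 hB.le
      _ = c * Real.sqrt ν / 2 := by rw [h4]; field_simp
  linarith [h1.trans (le_of_eq h2)]

/-- The dial's Type-I corner: a sup-rate of exponent exactly `1/2` on `(T₃, T)` is Type I blow-up in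
the tree's sense (`IsTypeIBlowup`: `‖u(t,x)‖ ≤ C/√(T−t)` eventually as `t ↑ T`). [folklore] -/
theorem isTypeIBlowup_of_supRate_half {T : ℝ}
    {u : ℝ → EuclideanSpace ℝ (Fin 3) → EuclideanSpace ℝ (Fin 3)}
    (h : ∃ A T₃ : ℝ, T₃ < T ∧ ∀ t ∈ Ioo T₃ T, ∀ x, ‖u t x‖ ≤ A * (T - t) ^ (-(1 / 2 : ℝ))) :
    IsTypeIBlowup u T := by
  obtain ⟨A, T₃, hT₃, hA⟩ := h
  refine ⟨A, ?_⟩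
  have hmem : Ioo T₃ T ∈ 𝓝[<] T := Ioo_mem_nhdsLT hT₃
  filter_upwards [hmem] with t ht x
  have hTt : 0 < T - t := sub_pos.2 ht.2
  have h := hA t ht x
  rwa [Real.rpow_neg hTt.le, ← Real.sqrt_eq_rpow, ← div_eq_mul_inv] at h

end SupRateClockScarLaw

end Summit.NavierStokesRegularity.NavierStokesRegularity.Theorems
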